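import Literature.AlgebraicGeometry.ModuliOfAbelianVarieties.Lan2013.Sec115InvolutionsClassification
import HarnessLib

/-!
# Lan 2013, §1.1.5 — kernel companions for the statement carpet `Sec115InvolutionsClassification`

Theorem-only companion (squad TS ruling TS-1; cell hodgecm-mathlib, seat TS-t06) of
`Literature/AlgebraicGeometry/ModuliOfAbelianVarieties/Lan2013/Sec115InvolutionsClassification.lean`.

* `Lan2013_1158_of_1157` — Corollary 1.1.5.8 follows from Lemma 1.1.5.7 by the printed two-line proof
  [Lan2013PELCompactifications, p. 23; 2010 rev. p. 26]: «take `e` as in Lemma 1.1.5.7 and `δ = eγ`, then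
  `δ − δ⋆ = eγ − e⋆γ⋆ = (e + e⋆)γ = γ`».  The kernel check exercises the typing of `𝒪_{F,R}` as star pairs
  (`IsStarPairOFR`): star pairs are closed under products (index set `Fin n × Fin m`, the starred partner uses that `⋆` of a
  central element is central).

No definitions, no new facts, no `sorry`; net debt 0 (Cor. 1.1.5.8 becomes closed modulo Lem. 1.1.5.7).
-/

open scoped TensorProduct

namespace Literature.AlgebraicGeometry.ModuliOfAbelianVarieties.Lan2013.Sec115InvolutionsClassificationHolds

open Literature.AlgebraicGeometry.ModuliOfAbelianVarieties.Lan2013.Sec112Sec113DeterminantsProjectiveModules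
open Literature.AlgebraicGeometry.ModuliOfAbelianVarieties.Lan2013.Sec114Pairings
open Literature.AlgebraicGeometry.ModuliOfAbelianVarieties.Lan2013.Sec115InvolutionsClassification

universe u

section StarPairs

variable {R₀ : Type*} [CommRing R₀] {K₀ : Type*} [Field K₀]
variable {A : Type*} [Ring A] [StarRing A] [Algebra K₀ A] [Algebra R₀ A]
variable {O : Subalgebra R₀ A} {R : Type*} [CommRing R] [Algebra R₀ R]

/-- `⋆` of a central element is central. [folklore] -/
private theorem star_mem_center {z : A} (hz : z ∈ Subalgebra.center K₀ A) : star z ∈ Subalgebra.center K₀ A := by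
  rw [Subalgebra.mem_center_iff] at hz ⊢
  intro b
  have h := congrArg star (hz (star b))
  simpa [star_mul] using h.symm

/-- Star pairs of `𝒪_{F,R} = R ⊗ 𝒪_F` are closed under products. [folklore] -/
private theorem isStarPairOFR_mul {x x' y y' : R ⊗[R₀] O} (hx : IsStarPairOFR K₀ O R x x')
    (hy : IsStarPairOFR K₀ O R y y') : IsStarPairOFR K₀ O R (x * y) (x' * y') := by
  obtain ⟨n, r, z, z', hz, rfl, rfl⟩ := hx
  obtain ⟨m, s, w, w', hw, rfl, rfl⟩ := hy
  let e : Fin n × Fin m ≃ Fin (n * m) := finProdFinEquiv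
  refine ⟨n * m, fun k => r (e.symm k).1 * s (e.symm k).2, fun k => z (e.symm k).1 * w (e.symm k).2,
    fun k => z' (e.symm k).1 * w' (e.symm k).2, fun k => ⟨?_, ?_⟩, ?_, ?_⟩
  · rw [Subalgebra.coe_mul]
    exact Subalgebra.mul_mem _ (hz _).1 (hw _).1
  · rw [Subalgebra.coe_mul, Subalgebra.coe_mul, (hz _).2, (hw _).2, star_mul]
    exact (Subalgebra.mem_center_iff.mp (star_mem_center (hz _).1) _).symm
  · simp only [Finset.sum_mul_sum, Algebra.TensorProduct.tmul_mul_tmul]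
    rw [← Fintype.sum_prod_type' (fun i j => (r i * s j) ⊗ₜ[R₀] (z i * w j))]
    exact (Equiv.sum_comp e.symm (fun p : Fin n × Fin m => (r p.1 * s p.2) ⊗ₜ[R₀] (z p.1 * w p.2))).symm
  · simp only [Finset.sum_mul_sum, Algebra.TensorProduct.tmul_mul_tmul]
    rw [← Fintype.sum_prod_type' (fun i j => (r i * s j) ⊗ₜ[R₀] (z' i * w' j))]
    exact (Equiv.sum_comp e.symm (fun p : Fin n × Fin m => (r p.1 * s p.2) ⊗ₜ[R₀] (z' p.1 * w' p.2))).symm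

/-- The printed proof of Corollary 1.1.5.8: with `e + e⋆ = 1` and `γ⋆ = −γ`, `δ := eγ` has `δ − δ⋆ = γ`.
[cite: Lan2013PELCompactifications, Cor. 1.1.5.8 (p. 23; 2010 rev. p. 26)] -/
theorem exists_starPair_sub_eq {e e' γ γ' : R ⊗[R₀] O} (he : IsStarPairOFR K₀ O R e e') (he1 : e + e' = 1)
    (hγ : IsStarPairOFR K₀ O R γ γ') (hγ0 : γ' + γ = 0) :
    ∃ δ δ' : R ⊗[R₀] O, IsStarPairOFR K₀ O R δ δ' ∧ γ = δ - δ' := by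
  refine ⟨e * γ, e' * γ', isStarPairOFR_mul he hγ, ?_⟩
  have h2 : e * γ - e' * γ' = (e + e') * γ - e' * (γ' + γ) := by
    rw [add_mul, mul_add]
    abel
  rw [h2, he1, hγ0, one_mul, mul_zero, sub_zero]

end StarPairs

/-- **Corollary 1.1.5.8 from Lemma 1.1.5.7**, by the printed proof («take `e` as in Lemma 1.1.5.7 and `δ = eγ`»).
[cite: Lan2013PELCompactifications, Cor. 1.1.5.8 (p. 23; 2010 rev. p. 26)] -/
theorem Lan2013_1158_of_1157 (h : Lan2013_1157.{u}) : Lan2013_1158.{u} := by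
  intro R₀ _ K₀ _ _ A _ _ _ _ _ Tr O k _ _ Λ _ _ _ _ _ R _ _ _ _ _ _ _ hS hF γ γ' hγ hγ0
  obtain ⟨e, e', he, he1⟩ := h R₀ K₀ A Tr O k Λ R hS hF
  exact exists_starPair_sub_eq he he1 hγ hγ0

end Literature.AlgebraicGeometry.ModuliOfAbelianVarieties.Lan2013.Sec115InvolutionsClassificationHolds
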